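import Summits.QuantumFields.BalabanUV.Beta.FP.WilsonCubicGerm
import Summits.QuantumFields.BalabanUV.Beta.FP.StencilMoments

/-!
# `BalabanUV.Beta.FP.CubicGermFunctional` — road «FP» for binder row D1, sub-row H2-G-FUNC of row H2-G (owner b2b-balaban-beta-d1-p3; `LEAVES-FP.md` row H2-G:
# «germ functional of a localised cubic stencil (first moments …)»): THE CUBIC GERM `cubicGermOf` IS A BOUNDED LINEAR FUNCTIONAL ON an2's `LocStencil` CLASS,
# CONTINUOUS UNDER UNIFORMLY LOCALISED POINTWISE CONVERGENCE

HONEST DEPENDENCY (page 1, mandatory): continuum YM on T⁴ ⇐ BetaPertH ∧ nine spine estimates (0/9 proved); BetaPertH ⇐ (D1) ∧ (D4) ∧ CAP+tail;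
G-an2-4 gates asym, D1 and NE2/3/4.  HONEST FRAMING (cell contract, verbatim): «discharging `BetaPertH` makes Bałaban's UV stability UNCONDITIONAL —
a real constructive-QFT result; it is NOT the continuum limit and NOT the Clay problem.»  THIS MODULE DISCHARGES NOTHING of the wall: it is `ℓ¹` bookkeeping
on `ℤ⁴ × ℤ⁴` ([folklore]; Mathlib + the tree's `ExpKernelCalculus` ∕ `FP/StencilMoments` BY NAME); 0 def, 0 cite, no `def … : Prop`, 0 sorry.  It touches NO object of
H2-V (effective vertices), says nothing about `SPerfOf`, decimation∕rescaling, Ward at the limit or PERM-COV.  NOT H2-G proper, NOT hasym, NOT D1, NOT BetaPertH, NOT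
continuum, NOT Clay.

ABSOLUTE RULE (cell charter, verbatim): «No internally-minted statement may enter as a cited fact. Every hypothesis is either kernel-proved in this package or a
verbatim quotation of a PUBLISHED theorem with page reference. The manuscript(s) under audit are NOT citable for their own disputed steps — they are the thing
under adjudication; programme-internal (2001/route/tribunal) claims are never citable.»

WHY.  `WilsonCubicGerm.cubicGermOf` (the row's CONVENTION OF RECORD, owner GO journal l.≈21086) is a `∑'` over ALL of `ℤ⁴ × ℤ⁴` precisely so that the SAME
functional applies to stencil families that are NOT finitely supported (the dressed ∕ perfect stencils of H2-V).  A `∑'` is additive and dominated-convergent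
only on summable families; this file supplies that on the class the cell already uses for first-order stencils, an2's `OneStepResolventKernel.LocStencil S Cs δ`
(`= ∀ κ′ u, BiLoc (S κ′ u) u u Cs δ`), `δ > 0`.

WHAT IS PROVED.
* §1 BI-LOCALISED KERNELS ON THE PRODUCT LATTICE (any dimension `D`, any fibre): `summable_prod_of_biLoc` (`(x,z) ↦ K x z a b` summable on `ℤ^D × ℤ^D`),
  `abs_tsum_prod_le_of_biLoc` (`|∑'_{(x,z)} K x z a b| ≤ C·Zl(δ)²`), `tsum_prod_eq_tsum_tsum_of_biLoc` (`∑'_{(x,z)} = ∑'_x ∑'_z`, for consumers holding row sums).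
* §2 THE GERM SUMMAND: `biLoc_germWeight` — multiplying the field–field member `S λ 0` by the first-order weight `x_κ` (resp. `z_κ`) keeps it bi-localised at `(0,0)`
  at HALF rate with constant `Cs·(1!·e^{δ/2}·(2/δ))` (`StencilMoments.biLoc_weight_fst ∕ _snd` BY NAME, `|x_κ| ≤ |x|₁ ≤ |x|₁ + 1`); hence (F1) `summable_germSummand`
  and (F2) **`abs_cubicGermOf_le`**: `|cubicGermOf S μ ν λ κ i| ≤ Cs · (e^{δ/2}·(2/δ)) · Zl 4 (δ/2)²`.
* §3 (F3) LINEARITY on `LocStencil` families: `cubicGermOf_add`, `cubicGermOf_smul` (unconditional), `cubicGermOf_neg`, `cubicGermOf_sub`; (F5) RATE **`abs_cubicGermOf_sub_le`**: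
  `LocStencil (S − T) ε δ → |cubicGermOf S … − cubicGermOf T …| ≤ ε · (e^{δ/2}·(2/δ)) · Zl 4 (δ/2)²`; with `cubicGermOf_wilsonA` (p236459) and an2's `locStencil_wilsonA`:
  **`abs_cubicGermOf_sub_ymGerm_le`** — a family `ε`-close to the level-0 Wilson table in `LocStencil` norm has germ `ε·G(δ)`-close to the Yang–Mills germ.
* §4 (F4) CONTINUITY **`tendsto_cubicGermOf`**: along ANY filter, if every `S j` is `LocStencil (S j) Cs δ` (uniform `Cs`, `δ > 0`) and the field–field entries at background
  site `0` converge pointwise to those of `T`, then `cubicGermOf (S j) μ ν λ κ i → cubicGermOf T μ ν λ κ i` (Mathlib `tendsto_tsum_of_dominated_convergence`, the §2 envelope as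
  the summable bound) — «the germ of a limit of uniformly localised stencils is the limit of the germs»; corollary `tendsto_cubicGermOf_ymGerm` (pointwise convergence to the
  Wilson table ⟹ germs → `ymGerm`).
* §5 (v1.1, the owner's request l.≈21449) the TWO-PARAMETER instances `tendsto_cubicGermOf_two` (`ℕ × ℕ`, `atTop ×ˢ atTop`), `tendsto_cubicGermOf_step` (fixed blocking,
  step `→ ∞`), `abs_cubicGermOf_sub_le_two` — one-line instances of §3–§4, which are stated for an arbitrary index type and filter.
Provenance: G-an2-4 formalisation swarm seat b2b-balaban-gan24-formalise-leaf-02 gen 36 (cross-lane on road FP), 2026-08-20.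
-/

noncomputable section

namespace Summit.QuantumFields.BalabanUV.Beta.FP.CubicGermFunctional

open Finset Filter Topology
open scoped BigOperators
open Literature.MathematicalPhysics.QuantumFieldTheory.Balaban1983to89
open Literature.MathematicalPhysics.QuantumFieldTheory.Balaban1983to89.Beta
open Literature.MathematicalPhysics.QuantumFieldTheory.Balaban1983to89.B12Sec2to5 (l1 l1_nonneg abs_coord_le_l1)
open Literature.MathematicalPhysics.QuantumFieldTheory.Balaban1983to89.Beta.ExpKernelCalculus (Site MKer BiLoc Zl Zl_pos Zl_nonneg summable_exp_shift'
  tsum_exp_shift')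
open Literature.MathematicalPhysics.QuantumFieldTheory.Balaban1983to89.Beta.OneStepResolventKernel (Fib LocStencil)
open Literature.MathematicalPhysics.QuantumFieldTheory.Balaban1983to89.Beta.StepJetData (wilsonA locStencil_wilsonA wBound)
open Summit.QuantumFields.BalabanUV.Beta.FP.StencilMoments (biLoc_weight_fst biLoc_weight_snd summable_row)
open Summit.QuantumFields.BalabanUV.Beta.FP.MarginalUniqueness (CubicGerm ymGerm)
open Summit.QuantumFields.BalabanUV.Beta.FP.WilsonCubicGerm (cubicGermOf cubicGermOf_wilsonA)

/-! ## §1 Bi-localised kernels are summable on the product lattice -/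

section Product

variable {D : ℕ} {F : Type*} {K : MKer D F} {p q : Site D} {C δ : ℝ}

/-- [folklore] the bi-localisation envelope factorises: `e^{−δ(|x−p|₁+|z−q|₁)} = e^{−δ|x−p|₁}·e^{−δ|z−q|₁}`. -/
theorem exp_envelope_eq (δ : ℝ) (x z p q : Site D) :
    Real.exp (-δ * (l1 (x - p) + l1 (z - q))) = Real.exp (-δ * l1 (x - p)) * Real.exp (-δ * l1 (z - q)) := by
  rw [← Real.exp_add]
  congr 1
  ring

/-- [folklore] the envelope `C·e^{−δ|x−p|₁}·e^{−δ|z−q|₁}` is summable on `ℤ^D × ℤ^D` (`δ > 0`). -/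
theorem summable_envelope (hδ : 0 < δ) (p q : Site D) (C : ℝ) :
    Summable fun xz : Site D × Site D => C * (Real.exp (-δ * l1 (xz.1 - p)) * Real.exp (-δ * l1 (xz.2 - q))) :=
  ((summable_exp_shift' hδ p).mul_of_nonneg (summable_exp_shift' hδ q) (fun _ => (Real.exp_pos _).le)
    (fun _ => (Real.exp_pos _).le)).mul_left C

/-- [folklore] … with total `C·Zl(δ)²`. -/
theorem tsum_envelope (hδ : 0 < δ) (p q : Site D) (C : ℝ) :
    ∑' xz : Site D × Site D, C * (Real.exp (-δ * l1 (xz.1 - p)) * Real.exp (-δ * l1 (xz.2 - q))) = C * Zl D δ ^ 2 := by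
  have hf : Summable fun x : Site D => ‖Real.exp (-δ * l1 (x - p))‖ := by
    simpa only [Real.norm_eq_abs, abs_of_pos (Real.exp_pos _)] using summable_exp_shift' hδ p
  have hg : Summable fun z : Site D => ‖Real.exp (-δ * l1 (z - q))‖ := by
    simpa only [Real.norm_eq_abs, abs_of_pos (Real.exp_pos _)] using summable_exp_shift' hδ q
  rw [tsum_mul_left, ← tsum_mul_tsum_of_summable_norm hf hg, tsum_exp_shift', tsum_exp_shift', sq]

/-- [folklore] **A BI-LOCALISED KERNEL IS SUMMABLE ON THE PRODUCT LATTICE** (`δ > 0`): `(x,z) ↦ K x z a b` is summable on `ℤ^D × ℤ^D`. -/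
theorem summable_prod_of_biLoc (hK : BiLoc K p q C δ) (hδ : 0 < δ) (a b : F) : Summable fun xz : Site D × Site D => K xz.1 xz.2 a b :=
  Summable.of_norm_bounded (summable_envelope hδ p q C) fun xz => by
    rw [Real.norm_eq_abs, ← exp_envelope_eq]
    exact hK xz.1 xz.2 a b

/-- [folklore] **THE DOUBLE TOTAL**: `|∑'_{(x,z)} K x z a b| ≤ C·Zl(δ)²`. -/
theorem abs_tsum_prod_le_of_biLoc (hK : BiLoc K p q C δ) (hδ : 0 < δ) (a b : F) :
    |∑' xz : Site D × Site D, K xz.1 xz.2 a b| ≤ C * Zl D δ ^ 2 := by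
  have h := tsum_of_norm_bounded (summable_envelope hδ p q C).hasSum (f := fun xz : Site D × Site D => K xz.1 xz.2 a b) fun xz => by
    rw [Real.norm_eq_abs, ← exp_envelope_eq]
    exact hK xz.1 xz.2 a b
  rwa [Real.norm_eq_abs, tsum_envelope hδ] at h

/-- [folklore] ITERATED FORM (for consumers holding row sums, `StencilMoments.summable_row`): `∑'_{(x,z)} K x z a b = ∑'_x ∑'_z K x z a b`. -/
theorem tsum_prod_eq_tsum_tsum_of_biLoc (hK : BiLoc K p q C δ) (hδ : 0 < δ) (a b : F) :
    ∑' xz : Site D × Site D, K xz.1 xz.2 a b = ∑' x, ∑' z, K x z a b :=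
  (summable_prod_of_biLoc hK hδ a b).tsum_prod' fun x => summable_row hK hδ x a b

end Product

/-! ## §2 The germ summand of a `LocStencil` family is bi-localised at half rate; (F1) summability, (F2) the bound -/

section Germ

variable {S T : Fin 4 → (Fin 4 → ℤ) → MKer 4 (Fib 3)} {Cs Ct ε δ : ℝ}

/-- [folklore] the first-order weights are dominated by `|·|₁ + 1` relative to the origin: `|x_κ| ≤ |x − 0|₁ + 1`. -/
theorem abs_coord_le_l1_add_one (x : Fin 4 → ℤ) (κ : Fin 4) : |((x κ : ℤ) : ℝ)| ≤ (l1 (x - 0) + 1) ^ 1 := by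
  rw [sub_zero, pow_one]
  exact (abs_coord_le_l1 x κ).trans (le_add_of_nonneg_right zero_le_one)

/-- [folklore] **THE GERM SUMMAND IS BI-LOCALISED AT HALF RATE**: for `LocStencil S Cs δ` (`δ > 0`) the weighted field–field member
`(x,z) ↦ w_i(x,z)·S λ 0 x z a b`, `w_0 = x_κ`, `w_1 = z_κ`, is `BiLoc … 0 0 (Cs·(1!·e^{δ/2}·(2/δ)^1)) (δ/2)`. -/
theorem biLoc_germWeight (hS : LocStencil S Cs δ) (hδ : 0 < δ) (lam κ : Fin 4) (i : Fin 2) :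
    BiLoc (fun x z (a b : Fib 3) => (((if i = 0 then x κ else z κ) : ℤ) : ℝ) * S lam 0 x z a b) 0 0
      (Cs * (((1 : ℕ).factorial : ℝ) * Real.exp (δ / 2) * (2 / δ) ^ 1)) (δ / 2) := by
  have h0 : BiLoc (S lam 0) 0 0 Cs δ := hS lam 0
  by_cases hi : i = 0
  · simp only [hi, ↓reduceIte]
    exact biLoc_weight_fst h0 hδ (φ := fun x : Fin 4 → ℤ => ((x κ : ℤ) : ℝ)) (k := 1) fun x => abs_coord_le_l1_add_one x κ
  · simp only [hi, ↓reduceIte]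
    exact biLoc_weight_snd h0 hδ (φ := fun z : Fin 4 → ℤ => ((z κ : ℤ) : ℝ)) (k := 1) fun z => abs_coord_le_l1_add_one z κ

/-- [folklore] the constant of §2 in closed form: `Cs·(1!·e^{δ/2}·(2/δ)^1) = Cs·(e^{δ/2}·(2/δ))`. -/
theorem germConst_eq (Cs δ : ℝ) : Cs * (((1 : ℕ).factorial : ℝ) * Real.exp (δ / 2) * (2 / δ) ^ 1) = Cs * (Real.exp (δ / 2) * (2 / δ)) := by
  rw [Nat.factorial_one, Nat.cast_one, one_mul, pow_one]

/-- [folklore] **(F1) SUMMABILITY OF THE GERM SUMMAND** on `ℤ⁴ × ℤ⁴`. -/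
theorem summable_germSummand (hS : LocStencil S Cs δ) (hδ : 0 < δ) (μ ν lam κ : Fin 4) (i : Fin 2) :
    Summable fun xz : (Fin 4 → ℤ) × (Fin 4 → ℤ) =>
      S lam 0 xz.1 xz.2 (Sum.inl μ) (Sum.inl ν) * (((if i = 0 then xz.1 κ else xz.2 κ) : ℤ) : ℝ) := by
  have h := summable_prod_of_biLoc (biLoc_germWeight hS hδ lam κ i) (half_pos hδ) (Sum.inl μ) (Sum.inl ν)
  exact h.congr fun xz => mul_comm _ _

/-- [folklore] **(F2) THE GERM IS BOUNDED ON THE `LocStencil` CLASS**: `|cubicGermOf S μ ν λ κ i| ≤ Cs·(e^{δ/2}·(2/δ))·Zl 4 (δ/2)²`. -/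
theorem abs_cubicGermOf_le (hS : LocStencil S Cs δ) (hδ : 0 < δ) (μ ν lam κ : Fin 4) (i : Fin 2) :
    |cubicGermOf S μ ν lam κ i| ≤ Cs * (Real.exp (δ / 2) * (2 / δ)) * Zl 4 (δ / 2) ^ 2 := by
  have h := abs_tsum_prod_le_of_biLoc (biLoc_germWeight hS hδ lam κ i) (half_pos hδ) (Sum.inl μ) (Sum.inl ν)
  rw [germConst_eq] at h
  refine le_of_eq_of_le (congrArg _ (tsum_congr fun xz => mul_comm _ _)) h

end Germ

/-! ## §3 (F3) Linearity on `LocStencil` families; (F5) the rate form; closeness to the Wilson table -/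

section Linear

variable {S T : Fin 4 → (Fin 4 → ℤ) → MKer 4 (Fib 3)} {Cs Ct ε δ δ' : ℝ}

/-- [folklore] **ADDITIVITY** (needs summability of both — `∑'` is not additive otherwise): `cubicGermOf (S + T) = cubicGermOf S + cubicGermOf T`. -/
theorem cubicGermOf_add (hS : LocStencil S Cs δ) (hδ : 0 < δ) (hT : LocStencil T Ct δ') (hδ' : 0 < δ') :
    cubicGermOf (S + T) = cubicGermOf S + cubicGermOf T := by
  funext μ ν lam κ i
  show (∑' xz : (Fin 4 → ℤ) × (Fin 4 → ℤ), (S lam 0 xz.1 xz.2 (Sum.inl μ) (Sum.inl ν) + T lam 0 xz.1 xz.2 (Sum.inl μ) (Sum.inl ν)) *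
      (((if i = 0 then xz.1 κ else xz.2 κ) : ℤ) : ℝ)) = cubicGermOf S μ ν lam κ i + cubicGermOf T μ ν lam κ i
  simp only [add_mul]
  exact (summable_germSummand hS hδ μ ν lam κ i).tsum_add (summable_germSummand hT hδ' μ ν lam κ i)

/-- [folklore] **HOMOGENEITY** (unconditional): `cubicGermOf (c • S) = c • cubicGermOf S`. -/
theorem cubicGermOf_smul (c : ℝ) (S : Fin 4 → (Fin 4 → ℤ) → MKer 4 (Fib 3)) : cubicGermOf (c • S) = c • cubicGermOf S := by
  funext μ ν lam κ i
  show (∑' xz : (Fin 4 → ℤ) × (Fin 4 → ℤ), (c * S lam 0 xz.1 xz.2 (Sum.inl μ) (Sum.inl ν)) * (((if i = 0 then xz.1 κ else xz.2 κ) : ℤ) : ℝ)) =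
    c * cubicGermOf S μ ν lam κ i
  simp only [mul_assoc]
  exact tsum_mul_left

/-- [folklore] `cubicGermOf (−S) = −cubicGermOf S` (unconditional). -/
theorem cubicGermOf_neg (S : Fin 4 → (Fin 4 → ℤ) → MKer 4 (Fib 3)) : cubicGermOf (-S) = -cubicGermOf S := by
  funext μ ν lam κ i
  show (∑' xz : (Fin 4 → ℤ) × (Fin 4 → ℤ), (-S lam 0 xz.1 xz.2 (Sum.inl μ) (Sum.inl ν)) * (((if i = 0 then xz.1 κ else xz.2 κ) : ℤ) : ℝ)) =
    -cubicGermOf S μ ν lam κ i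
  simp only [neg_mul]
  exact tsum_neg

/-- [folklore] a negated `LocStencil` family is `LocStencil` with the same constants. -/
theorem locStencil_neg (hT : LocStencil T Ct δ') : LocStencil (-T) Ct δ' := by
  intro κ' u x z a b
  show |(-T κ' u x z a b)| ≤ _
  rw [abs_neg]
  exact hT κ' u x z a b

/-- [folklore] **SUBTRACTION**: `cubicGermOf (S − T) = cubicGermOf S − cubicGermOf T` on `LocStencil` families. -/
theorem cubicGermOf_sub (hS : LocStencil S Cs δ) (hδ : 0 < δ) (hT : LocStencil T Ct δ') (hδ' : 0 < δ') :
    cubicGermOf (S - T) = cubicGermOf S - cubicGermOf T := by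
  rw [sub_eq_add_neg, cubicGermOf_add hS hδ (locStencil_neg hT) hδ', cubicGermOf_neg, ← sub_eq_add_neg]

/-- [folklore] **(F5) THE RATE FORM**: if the DIFFERENCE family is `LocStencil (S − T) ε δ` then every germ entry of `S` is within `ε·(e^{δ/2}·(2/δ))·Zl 4 (δ/2)²`
of that of `T`. -/
theorem abs_cubicGermOf_sub_le (hS : LocStencil S Cs δ) (hT : LocStencil T Ct δ') (hST : LocStencil (S - T) ε δ) (hδ : 0 < δ) (hδ' : 0 < δ')
    (μ ν lam κ : Fin 4) (i : Fin 2) :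
    |cubicGermOf S μ ν lam κ i - cubicGermOf T μ ν lam κ i| ≤ ε * (Real.exp (δ / 2) * (2 / δ)) * Zl 4 (δ / 2) ^ 2 := by
  have h := abs_cubicGermOf_le hST hδ μ ν lam κ i
  rwa [cubicGermOf_sub hS hδ hT hδ'] at h

/-- [our object] **CLOSENESS TO THE WILSON TABLE ⟹ CLOSENESS TO THE YANG–MILLS GERM** (`cubicGermOf_wilsonA` p236459 + an2's `locStencil_wilsonA`): a family whose
difference to the level-0 Wilson table is `LocStencil (S − wilsonA 3) ε δ` has every germ entry within `ε·(e^{δ/2}·(2/δ))·Zl 4 (δ/2)²` of `ymGerm`. -/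
theorem abs_cubicGermOf_sub_ymGerm_le (hS : LocStencil S Cs δ) (hSW : LocStencil (S - wilsonA 3) ε δ) (hδ : 0 < δ) (μ ν lam κ : Fin 4) (i : Fin 2) :
    |cubicGermOf S μ ν lam κ i - ymGerm μ ν lam κ i| ≤ ε * (Real.exp (δ / 2) * (2 / δ)) * Zl 4 (δ / 2) ^ 2 := by
  rw [← cubicGermOf_wilsonA]
  exact abs_cubicGermOf_sub_le hS (locStencil_wilsonA (d := 3) hδ.le) hSW hδ hδ μ ν lam κ i

end Linear

/-! ## §4 (F4) Continuity: the germ of a limit of uniformly localised stencils is the limit of the germs -/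

section Limit

variable {ι : Type*} {l : Filter ι} {S : ι → Fin 4 → (Fin 4 → ℤ) → MKer 4 (Fib 3)} {T : Fin 4 → (Fin 4 → ℤ) → MKer 4 (Fib 3)} {Cs δ : ℝ}

/-- [folklore] **(F4) DOMINATED CONVERGENCE FOR THE GERM**: a family `S j` of stencil families, UNIFORMLY `LocStencil (S j) Cs δ` (`δ > 0`), whose field–field
entries at the background site `0` converge pointwise along the filter `l` to those of `T`, has `cubicGermOf (S j) μ ν λ κ i → cubicGermOf T μ ν λ κ i`
(Mathlib `tendsto_tsum_of_dominated_convergence`; NO hypothesis on `T` beyond being the pointwise limit). -/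
theorem tendsto_cubicGermOf (hS : ∀ j, LocStencil (S j) Cs δ) (hδ : 0 < δ) (μ ν lam κ : Fin 4) (i : Fin 2)
    (hlim : ∀ x z : Fin 4 → ℤ, Tendsto (fun j => S j lam 0 x z (Sum.inl μ) (Sum.inl ν)) l (𝓝 (T lam 0 x z (Sum.inl μ) (Sum.inl ν)))) :
    Tendsto (fun j => cubicGermOf (S j) μ ν lam κ i) l (𝓝 (cubicGermOf T μ ν lam κ i)) := by
  unfold cubicGermOf
  refine tendsto_tsum_of_dominated_convergence
    (bound := fun xz : (Fin 4 → ℤ) × (Fin 4 → ℤ) =>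
      Cs * (Real.exp (δ / 2) * (2 / δ)) * (Real.exp (-(δ / 2) * l1 (xz.1 - 0)) * Real.exp (-(δ / 2) * l1 (xz.2 - 0))))
    (summable_envelope (half_pos hδ) 0 0 _) (fun xz => (hlim xz.1 xz.2).mul_const _) (Eventually.of_forall fun j xz => ?_)
  have h := biLoc_germWeight (hS j) hδ lam κ i xz.1 xz.2 (Sum.inl μ) (Sum.inl ν)
  rw [germConst_eq, exp_envelope_eq] at h
  rw [Real.norm_eq_abs, mul_comm]
  exact h

/-- [our object] COROLLARY: uniformly localised families whose field–field entries converge pointwise to an2's level-0 Wilson table have germs converging to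
the Yang–Mills germ (`cubicGermOf_wilsonA`). -/
theorem tendsto_cubicGermOf_ymGerm (hS : ∀ j, LocStencil (S j) Cs δ) (hδ : 0 < δ) (μ ν lam κ : Fin 4) (i : Fin 2)
    (hlim : ∀ x z : Fin 4 → ℤ,
      Tendsto (fun j => S j lam 0 x z (Sum.inl μ) (Sum.inl ν)) l (𝓝 (wilsonA 3 lam 0 x z (Sum.inl μ) (Sum.inl ν)))) :
    Tendsto (fun j => cubicGermOf (S j) μ ν lam κ i) l (𝓝 (ymGerm μ ν lam κ i)) := by
  rw [← cubicGermOf_wilsonA]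
  exact tendsto_cubicGermOf hS hδ μ ν lam κ i hlim

end Limit

/-! ## §5 (v1.1, owner's request journal l.≈21449) The two-parameter instance: families `S j k` uniformly localised in BOTH indices -/

section TwoParameter

variable {S : ℕ → ℕ → Fin 4 → (Fin 4 → ℤ) → MKer 4 (Fib 3)} {T : Fin 4 → (Fin 4 → ℤ) → MKer 4 (Fib 3)} {Cs δ : ℝ}

/-- [folklore] **(F4) FOR A TWO-PARAMETER FAMILY** (step `k → ∞` and blocking `j → ∞` JOINTLY, the shape the slot rows + REBASE deliver): if every `S j k` is
`LocStencil (S j k) Cs δ` with ONE pair `(Cs, δ)`, `δ > 0`, and the field–field entries at background site `0` converge along `atTop ×ˢ atTop` to those of `T`, then so do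
the germs.  (This is `tendsto_cubicGermOf` at the index type `ℕ × ℕ`; §4 is stated for an ARBITRARY index type and filter, so any other directed re-indexing — `k → ∞` at
fixed `j`, a diagonal `k = φ j`, `Filter.atTop` of the product ORDER — is the same one-line instance.) -/
theorem tendsto_cubicGermOf_two (hS : ∀ j k, LocStencil (S j k) Cs δ) (hδ : 0 < δ) (μ ν lam κ : Fin 4) (i : Fin 2)
    (hlim : ∀ x z : Fin 4 → ℤ, Tendsto (fun jk : ℕ × ℕ => S jk.1 jk.2 lam 0 x z (Sum.inl μ) (Sum.inl ν)) (atTop ×ˢ atTop)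
      (𝓝 (T lam 0 x z (Sum.inl μ) (Sum.inl ν)))) :
    Tendsto (fun jk : ℕ × ℕ => cubicGermOf (S jk.1 jk.2) μ ν lam κ i) (atTop ×ˢ atTop) (𝓝 (cubicGermOf T μ ν lam κ i)) :=
  tendsto_cubicGermOf (S := fun jk : ℕ × ℕ => S jk.1 jk.2) (fun jk => hS jk.1 jk.2) hδ μ ν lam κ i hlim

/-- [folklore] the same at FIXED blocking `j`, step `k → ∞` (the slot rows' native limit). -/
theorem tendsto_cubicGermOf_step (hS : ∀ j k, LocStencil (S j k) Cs δ) (hδ : 0 < δ) (j : ℕ) (μ ν lam κ : Fin 4) (i : Fin 2)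
    (hlim : ∀ x z : Fin 4 → ℤ, Tendsto (fun k => S j k lam 0 x z (Sum.inl μ) (Sum.inl ν)) atTop (𝓝 (T lam 0 x z (Sum.inl μ) (Sum.inl ν)))) :
    Tendsto (fun k => cubicGermOf (S j k) μ ν lam κ i) atTop (𝓝 (cubicGermOf T μ ν lam κ i)) :=
  tendsto_cubicGermOf (S := fun k => S j k) (fun k => hS j k) hδ μ ν lam κ i hlim

/-- [folklore] **(F5) FOR A TWO-PARAMETER FAMILY**: a rate `LocStencil (S j k − T) (ε j k) δ` uniform in shape gives
`|cubicGermOf (S j k) … − cubicGermOf T …| ≤ ε j k · (e^{δ/2}·(2/δ)) · Zl 4 (δ/2)²` for every `j k` — so any `ε j k → 0` regime (joint, iterated, diagonal) transfers. -/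
theorem abs_cubicGermOf_sub_le_two {Ct δ' : ℝ} {ε : ℕ → ℕ → ℝ} (hS : ∀ j k, LocStencil (S j k) Cs δ) (hT : LocStencil T Ct δ')
    (hST : ∀ j k, LocStencil (S j k - T) (ε j k) δ) (hδ : 0 < δ) (hδ' : 0 < δ') (j k : ℕ) (μ ν lam κ : Fin 4) (i : Fin 2) :
    |cubicGermOf (S j k) μ ν lam κ i - cubicGermOf T μ ν lam κ i| ≤ ε j k * (Real.exp (δ / 2) * (2 / δ)) * Zl 4 (δ / 2) ^ 2 :=
  abs_cubicGermOf_sub_le (hS j k) hT (hST j k) hδ hδ' μ ν lam κ i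

end TwoParameter

end Summit.QuantumFields.BalabanUV.Beta.FP.CubicGermFunctional
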